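import Literature.Topology.FourManifolds.SphereIsometryDiffeotopy
import Literature.Topology.FourManifolds.RadialExtension
import Mathlib.Analysis.InnerProductSpace.GramSchmidtOrtho
import HarnessLib

/-!
# The Gram–Schmidt frame loop of a diffeotopy of `𝕊ⁿ` at a point

Topic `Literature/Topology/FourManifolds`. Companion of `LoopRealisation.lean` (not imported here)
in the proof of the **injectivity half of Cerf's Proposition 4 at `i = 0`** (Cerf, *Sur les
difféomorphismes de la sphère de dimension trois*, LNM 53 (1968), Appendice §5, Prop. 4; Ch. I §2,
first sentence: "le théorème 1 équivaut à (2) `π₀(Diff(D³; S²)) = 0`"), assembled in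
`CerfPropositionFourInjective.lean`.

Cerf's argument restricts a path `t ↦ F_t` in `Diff Sⁿ` to a disc around a point `v` and uses
that the space of embedded discs is `≃ SO(n+1)` (Appendice, Prop. 3) together with the covering
homotopy property of `Diff Sⁿ → Emb(Dⁿ, Sⁿ)`. Here the `SO(n+1)`-part of the `1`-jet of `F_t`
at `v` is split off *canonically*, by Gram–Schmidt:

**Main result** (`exists_frameLoop`). Let `D` be a diffeotopy of `𝕊ⁿ` which is the identity
for `t ≤ 0`, stationary for `t ≥ 1`, and whose final stage is the identity near `v ∈ 𝕊ⁿ`. Let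
`M_t ∈ GL(n+1)` be the differential at `v` of the degree-one homogeneous extension of the stage
`F_t` to `ℝⁿ⁺¹ ∖ 0`, and `A_t ∈ O(n+1)` the isometry carrying an orthonormal basis
`b = (v, b₁, …, bₙ)` to the Gram–Schmidt orthonormalisation of `(M_t v, M_t b₁, …, M_t bₙ)`. Then
`t ↦ A_t` is a **smooth loop of isometries** (`A_t = 1` for `t ≤ 0` and `t ≥ 1`) with
`A_t v = F_t v`, and for the corrected family `E_t = A_t⁻¹ ∘ F_t` (which fixes `v`) read in the
stereographic chart at `v`, `e_t = σ_{-v} ∘ E_t ∘ σ_{-v}⁻¹`, **every segment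
`(1 - s) De_t(0) + s · 1`, `s ∈ [0, 1]`, is invertible** — because `A_t⁻¹ M_t` is upper
triangular with positive diagonal in the basis `b` (flag-positivity of Gram–Schmidt), a convex
condition preserved along the segment to the identity and transported to the chart by the chain
rule. This is exactly the input of the loop realisation theorem of `LoopRealisation.lean`.

Contents: §1 Gram–Schmidt along smooth families (smoothness, `⟪gs_k, f_k⟫ = ‖gs_k‖²`,
flag-positivity ⟹ injectivity of the segment); §2 the homogeneous extension of sphere maps and its
`1`-jet at a point (radial direction, tangency, invertibility); §3 the stereographic chart at `v`
read through the ambient formulas (`V ∘ U = id`, `DV(v) ∘ DU(0) = 1`, `range DU(0) = vᗮ`);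
§4 the frame loop. Everything is proved; the file declares only theorems.

## References

* J. Cerf, *Sur les difféomorphismes de la sphère de dimension trois (Γ₄ = 0)*, LNM 53 (1968),
  Ch. I §2 (first sentence); Appendice §5, Propositions 3, 4. [CerfDiffeoSphere1968]
* M. W. Hirsch, *Differential Topology*, GTM 33 (1976), Ch. 4 §4 and Ch. 8 §3 (Gram–Schmidt
  deformation `GL → O`, linearisation of disc embeddings). [HirschDT1976]
-/

open scoped Manifold ContDiff Topology RealInnerProductSpace
open Function Set Filter Metric Module InnerProductSpace

noncomputable section

namespace Literature.Topology.FourManifolds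

/-! ## §1 Gram–Schmidt along smooth families; flag-positivity -/

section GramSchmidt

variable {F : Type*} [NormedAddCommGroup F] [InnerProductSpace ℝ F]
  {ι : Type*} [LinearOrder ι] [LocallyFiniteOrderBot ι] [WellFoundedLT ι]

/-- `⟪gs_k, f_k⟫ = ‖gs_k‖²` for the Gram–Schmidt orthogonalisation `gs` of `f`: the `k`-th input
vector differs from `gs_k` by a combination of the earlier, orthogonal, `gs_i`. [folklore] -/
theorem inner_gramSchmidt_self (f : ι → F) (k : ι) :
    ⟪gramSchmidt ℝ f k, f k⟫ = ‖gramSchmidt ℝ f k‖ ^ 2 := by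
  conv_lhs => rw [gramSchmidt_def'' ℝ f k]
  rw [inner_add_right, real_inner_self_eq_norm_sq, inner_sum, add_eq_left]
  refine Finset.sum_eq_zero fun i hi => ?_
  rw [inner_smul_right, gramSchmidt_orthogonal ℝ f (Finset.mem_Iio.mp hi).ne', mul_zero]

/-- **Gram–Schmidt is smooth along smooth families of linearly independent tuples**: if each
`x ↦ u x i` is `C^∞` and every tuple `u x` is linearly independent, then each
`x ↦ gramSchmidt ℝ (u x) i` is `C^∞` (the recursion only divides by the nonvanishing `‖gs_i‖²`).
[folklore] -/
theorem contDiff_gramSchmidt {X : Type*} [NormedAddCommGroup X] [NormedSpace ℝ X]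
    {u : X → ι → F} (hu : ∀ i, ContDiff ℝ ∞ fun x => u x i)
    (hli : ∀ x, LinearIndependent ℝ (u x)) (i : ι) :
    ContDiff ℝ ∞ fun x => gramSchmidt ℝ (u x) i := by
  induction i using WellFoundedLT.induction with
  | _ i ih =>
    have h : (fun x => gramSchmidt ℝ (u x) i) = fun x => u x i -
        ∑ j ∈ Finset.Iio i, (⟪gramSchmidt ℝ (u x) j, u x i⟫ /
          ‖gramSchmidt ℝ (u x) j‖ ^ 2) • gramSchmidt ℝ (u x) j := by
      funext x
      conv_lhs => rw [eq_sub_of_add_eq (gramSchmidt_def'' ℝ (u x) i).symm]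
      simp
    rw [h]
    refine (hu i).sub (ContDiff.sum fun j hj => ?_)
    have hj' : j < i := Finset.mem_Iio.mp hj
    have hne : ∀ x, ‖gramSchmidt ℝ (u x) j‖ ^ 2 ≠ 0 := fun x =>
      pow_ne_zero 2 (norm_ne_zero_iff.mpr (gramSchmidt_ne_zero j (hli x)))
    exact (((ih j hj').inner ℝ (hu i)).div ((ih j hj').norm_sq ℝ) hne).smul (ih j hj')

/-- The normalised Gram–Schmidt vectors are smooth along smooth families of linearly
independent tuples. [folklore] -/
theorem contDiff_gramSchmidtNormed {X : Type*} [NormedAddCommGroup X] [NormedSpace ℝ X]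
    {u : X → ι → F} (hu : ∀ i, ContDiff ℝ ∞ fun x => u x i)
    (hli : ∀ x, LinearIndependent ℝ (u x)) (i : ι) :
    ContDiff ℝ ∞ fun x => gramSchmidtNormed ℝ (u x) i := by
  have h0 : ∀ x, gramSchmidt ℝ (u x) i ≠ 0 := fun x => gramSchmidt_ne_zero i (hli x)
  have h1 := contDiff_gramSchmidt hu hli i
  show ContDiff ℝ ∞ fun x => (‖gramSchmidt ℝ (u x) i‖ : ℝ)⁻¹ • gramSchmidt ℝ (u x) i
  exact ((h1.norm ℝ h0).inv fun x => norm_ne_zero_iff.mpr (h0 x)).smul h1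

/-- **Flag-positive linear maps are injective.** If `S` maps each `b k` of an orthonormal basis
`b = (b₀, …, b_{m-1})` into `span {b_j : j ≤ k}` with `⟪b k, S b k⟫ > 0` (upper triangular with
positive diagonal), then `S` is injective: pair `S x` with `b k`, `k` the top index of `x`.
[folklore] -/
theorem injective_of_flagPositive {m : ℕ} (b : OrthonormalBasis (Fin m) ℝ F) (S : F →ₗ[ℝ] F)
    (hS : ∀ k, S (b k) ∈ Submodule.span ℝ (b '' Set.Iic k))
    (hpos : ∀ k, 0 < ⟪b k, S (b k)⟫) : Injective S := by
  rw [← LinearMap.ker_eq_bot, Submodule.eq_bot_iff]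
  intro x hx
  rw [LinearMap.mem_ker] at hx
  by_contra hx0
  -- the top index of `x` in the basis `b`
  set c := b.repr x with hc
  have hcne : ∃ k, c k ≠ 0 := by
    by_contra h
    push Not at h
    apply hx0
    rw [← b.sum_repr x]
    exact Finset.sum_eq_zero fun i _ => by rw [show b.repr x i = 0 from h i, zero_smul]
  classical
  set K : Finset (Fin m) := Finset.univ.filter fun k => c k ≠ 0 with hK
  have hKne : K.Nonempty := by
    obtain ⟨k, hk⟩ := hcne
    exact ⟨k, by simp [hK, hk]⟩
  set k := K.max' hKne with hk
  have hkK : k ∈ K := K.max'_mem hKne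
  have hck : c k ≠ 0 := by simpa [hK] using hkK
  have habove : ∀ j, k < j → c j = 0 := by
    intro j hj
    by_contra h
    have : j ∈ K := by simp [hK, h]
    exact absurd (K.le_max' j this) (not_le.mpr (hk ▸ hj))
  -- `⟪b k, S (b j)⟫ = 0` for `j < k`
  have hbelow : ∀ j, j < k → ⟪b k, S (b j)⟫ = 0 := by
    intro j hj
    have hmem := hS j
    refine Submodule.span_induction (p := fun y _ => ⟪b k, y⟫ = 0) ?_ ?_ ?_ ?_ hmem
    · rintro y ⟨i, hi, rfl⟩
      have hik : i ≠ k := (lt_of_le_of_lt hi hj).ne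
      exact b.orthonormal.2 hik.symm
    · exact inner_zero_right _
    · intro y z _ _ hy hz
      rw [inner_add_right, hy, hz, add_zero]
    · intro a y _ hy
      rw [inner_smul_right, hy, mul_zero]
  -- expand `x` in the basis and pair `S x` with `b k`
  have hx' : x = ∑ j, c j • b j := by
    rw [hc]
    exact (b.sum_repr x).symm
  have hSx : ⟪b k, S x⟫ = c k * ⟪b k, S (b k)⟫ := by
    rw [hx', map_sum, inner_sum]
    simp_rw [map_smul, inner_smul_right]
    rw [Finset.sum_eq_single k]
    · intro j _ hjk
      rcases lt_or_gt_of_ne hjk with hjk | hjk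
      · rw [hbelow j hjk, mul_zero]
      · rw [habove j hjk, zero_mul]
    · intro h; exact absurd (Finset.mem_univ k) h
  rw [hx, inner_zero_right] at hSx
  exact (mul_ne_zero hck (hpos k).ne') hSx.symm

/-- In finite dimension an injective continuous linear endomorphism is a unit of the ring of
continuous linear endomorphisms (companion of `isUnit_of_injective_clm`, `LoopRealisation.lean`,
which this file does not import). [folklore] -/
theorem isUnit_of_injective_clm' [FiniteDimensional ℝ F] [CompleteSpace F] {f : F →L[ℝ] F}
    (hf : Injective f) : IsUnit f := by
  rw [ContinuousLinearMap.isUnit_iff_isUnit_toLinearMap, LinearMap.isUnit_iff_ker_eq_bot]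
  exact LinearMap.ker_eq_bot.mpr hf

/-- **The segment from a flag-positive map to the identity stays flag-positive, hence
invertible**: for `s ∈ [0, 1]`, `(1 - s) S + s · 1` is a unit of `F →L[ℝ] F`. [folklore] -/
theorem isUnit_segment_of_flagPositive {m : ℕ} [FiniteDimensional ℝ F] [CompleteSpace F]
    (b : OrthonormalBasis (Fin m) ℝ F) (S : F →L[ℝ] F)
    (hS : ∀ k, S (b k) ∈ Submodule.span ℝ (b '' Set.Iic k))
    (hpos : ∀ k, 0 < ⟪b k, S (b k)⟫) {s : ℝ} (hs : s ∈ Icc (0 : ℝ) 1) :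
    IsUnit ((1 - s) • S + s • (1 : F →L[ℝ] F)) := by
  refine isUnit_of_injective_clm' ?_
  have h := injective_of_flagPositive b (((1 - s) • S + s • (1 : F →L[ℝ] F) : F →L[ℝ] F) :
      F →ₗ[ℝ] F) (fun k => ?_) (fun k => ?_)
  · exact h
  · show ((1 - s) • S + s • (1 : F →L[ℝ] F)) (b k) ∈ _
    rw [add_apply, smul_apply, smul_apply, one_apply_eq_self]
    refine Submodule.add_mem _ (Submodule.smul_mem _ _ (hS k)) (Submodule.smul_mem _ _ ?_)
    exact Submodule.subset_span ⟨k, Set.mem_Iic.mpr le_rfl, rfl⟩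
  · show 0 < ⟪b k, ((1 - s) • S + s • (1 : F →L[ℝ] F)) (b k)⟫
    rw [add_apply, smul_apply, smul_apply, one_apply_eq_self, inner_add_right, inner_smul_right,
      inner_smul_right, real_inner_self_eq_norm_sq, b.orthonormal.1 k, one_pow, mul_one]
    rcases eq_or_lt_of_le hs.2 with rfl | hs1
    · simp
    · have : 0 < (1 - s) * ⟪b k, S (b k)⟫ := mul_pos (by linarith) (hpos k)
      linarith [hs.1]

end GramSchmidt

/-! ## §2 The homogeneous extension of a sphere map and its `1`-jet at a point -/

section Homogeneous

/-- Local notation: `𝔼 n` is the model Euclidean space `EuclideanSpace ℝ (Fin n)`. -/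
local notation "𝔼 " n:arg => EuclideanSpace ℝ (Fin n)

/-- Local notation: `𝕊 n` is the unit sphere in `EuclideanSpace ℝ (Fin (n + 1))`. -/
local notation "𝕊 " n:arg => (Metric.sphere (0 : EuclideanSpace ℝ (Fin (n + 1))) 1)

attribute [local instance] fact_finrank_euclideanSpace_succ

variable {n : ℕ}

/-- On the sphere the homogeneous extension `x ↦ ‖x‖ • f(x/‖x‖)` of `f : 𝕊ⁿ → 𝕊ⁿ` restricts to
`f`. [folklore] -/
theorem homExt_coe_sphere (v : 𝕊 n) (f : (𝕊 n) → 𝕊 n) (z : 𝕊 n) :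
    ‖(z : 𝔼 (n + 1))‖ • ((f (radialProjection v (z : 𝔼 (n + 1))) : 𝕊 n) : 𝔼 (n + 1)) = f z := by
  rw [norm_eq_of_mem_sphere z, one_smul, radialProjection_coe_sphere]

/-- The homogeneous extension of the identity is the identity off the origin. [folklore] -/
theorem homExt_id {v : 𝕊 n} {x : 𝔼 (n + 1)} (hx : x ≠ 0) :
    ‖x‖ • ((radialProjection v x : 𝕊 n) : 𝔼 (n + 1)) = x := by
  rw [coe_radialProjection_of_ne_zero v hx, smul_inv_smul₀ (norm_ne_zero_iff.mpr hx)]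

/-- The homogeneous extension is norm-preserving. [folklore] -/
theorem norm_homExt (v : 𝕊 n) (f : (𝕊 n) → 𝕊 n) (x : 𝔼 (n + 1)) :
    ‖‖x‖ • ((f (radialProjection v x) : 𝕊 n) : 𝔼 (n + 1))‖ = ‖x‖ := by
  rw [norm_smul, norm_norm, norm_eq_of_mem_sphere, mul_one]

/-- The homogeneous extension is positively homogeneous of degree one. [folklore] -/
theorem homExt_smul (v : 𝕊 n) (f : (𝕊 n) → 𝕊 n) {c : ℝ} (hc : 0 < c) (x : 𝔼 (n + 1)) :
    ‖c • x‖ • ((f (radialProjection v (c • x)) : 𝕊 n) : 𝔼 (n + 1)) =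
      c • (‖x‖ • ((f (radialProjection v x) : 𝕊 n) : 𝔼 (n + 1))) := by
  by_cases hx : x = 0
  · simp [hx]
  · have hcx : c • x ≠ 0 := smul_ne_zero hc.ne' hx
    have hproj : radialProjection v (c • x) = radialProjection v x := by
      apply Subtype.ext
      rw [coe_radialProjection_of_ne_zero v hcx, coe_radialProjection_of_ne_zero v hx, norm_smul,
        Real.norm_eq_abs, abs_of_pos hc, mul_inv, smul_smul, mul_comm c⁻¹, mul_assoc,
        inv_mul_cancel₀ hc.ne', mul_one]
    rw [hproj, norm_smul, Real.norm_eq_abs, abs_of_pos hc, smul_smul]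

/-- The radial projection of the homogeneous extension is `f` of the radial projection.
[folklore] -/
theorem radialProjection_homExt (v : 𝕊 n) (f : (𝕊 n) → 𝕊 n) {x : 𝔼 (n + 1)} (hx : x ≠ 0) :
    radialProjection v (‖x‖ • ((f (radialProjection v x) : 𝕊 n) : 𝔼 (n + 1))) =
      f (radialProjection v x) := by
  apply Subtype.ext
  have hne : ‖x‖ • ((f (radialProjection v x) : 𝕊 n) : 𝔼 (n + 1)) ≠ 0 := by
    rw [← norm_ne_zero_iff, norm_homExt]; exact norm_ne_zero_iff.mpr hx
  rw [coe_radialProjection_of_ne_zero v hne, norm_homExt, smul_smul,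
    inv_mul_cancel₀ (norm_ne_zero_iff.mpr hx), one_smul]

/-- **Joint smoothness of the homogeneous extension of a jointly smooth family of sphere maps,
off the origin.** [folklore] -/
theorem contDiffAt_homExt_family (v : 𝕊 n) {F : ℝ → (𝕊 n) → 𝕊 n}
    (hF : ContMDiff (𝓘(ℝ, ℝ).prod (𝓡 n)) (𝓡 n) ∞ (uncurry F)) {t : ℝ} {x : 𝔼 (n + 1)}
    (hx : x ≠ 0) :
    ContDiffAt ℝ ∞ (uncurry fun t (x : 𝔼 (n + 1)) =>
      ‖x‖ • ((F t (radialProjection v x) : 𝕊 n) : 𝔼 (n + 1))) (t, x) := by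
  -- `(t, x) ↦ (t, x/‖x‖) ∈ ℝ × 𝕊ⁿ` is smooth at `(t, x)`
  have h1 : ContMDiffAt (𝓘(ℝ, ℝ).prod 𝓘(ℝ, 𝔼 (n + 1))) (𝓘(ℝ, ℝ).prod (𝓡 n)) ∞
      (fun q : ℝ × 𝔼 (n + 1) => (q.1, radialProjection v q.2)) (t, x) :=
    contMDiffAt_fst.prodMk ((contMDiffAt_radialProjection v hx).comp (t, x) contMDiffAt_snd)
  have h2 : ContMDiffAt (𝓘(ℝ, ℝ).prod 𝓘(ℝ, 𝔼 (n + 1))) 𝓘(ℝ, 𝔼 (n + 1)) ∞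
      (fun q : ℝ × 𝔼 (n + 1) => ((F q.1 (radialProjection v q.2) : 𝕊 n) : 𝔼 (n + 1))) (t, x) :=
    (contMDiff_coe_sphere.comp hF).contMDiffAt.comp (t, x) h1
  have h3 : ContDiffAt ℝ ∞
      (fun q : ℝ × 𝔼 (n + 1) => ((F q.1 (radialProjection v q.2) : 𝕊 n) : 𝔼 (n + 1))) (t, x) := by
    rw [← modelWithCornersSelf_prod, chartedSpaceSelf_prod] at h2
    exact h2.contDiffAt
  have h4 : ContDiffAt ℝ ∞ (fun q : ℝ × 𝔼 (n + 1) => ‖q.2‖) (t, x) :=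
    (contDiffAt_snd (p := (t, x))).norm ℝ hx
  exact h4.smul h3

/-- Smoothness of a single homogeneous extension off the origin. [folklore] -/
theorem contDiffAt_homExt (v : 𝕊 n) {f : (𝕊 n) → 𝕊 n} (hf : ContMDiff (𝓡 n) (𝓡 n) ∞ f)
    {x : 𝔼 (n + 1)} (hx : x ≠ 0) :
    ContDiffAt ℝ ∞ (fun x : 𝔼 (n + 1) =>
      ‖x‖ • ((f (radialProjection v x) : 𝕊 n) : 𝔼 (n + 1))) x := by
  have hF : ContMDiff (𝓘(ℝ, ℝ).prod (𝓡 n)) (𝓡 n) ∞ (uncurry fun (_ : ℝ) (z : 𝕊 n) => f z) :=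
    hf.comp contMDiff_snd
  exact (contDiffAt_homExt_family v hF (t := 0) hx).comp x (contDiffAt_const.prodMk contDiffAt_id)

/-- **Radial direction of the `1`-jet**: if `M` is the differential at the unit vector `v` of the
homogeneous extension of `f`, then `M v = f v` (differentiate `λ ↦ λ • f v`). [folklore] -/
theorem homExt_fderiv_apply_self (v : 𝕊 n) (f : (𝕊 n) → 𝕊 n) {M : 𝔼 (n + 1) →L[ℝ] 𝔼 (n + 1)}
    (hM : HasFDerivAt (fun x : 𝔼 (n + 1) =>
      ‖x‖ • ((f (radialProjection v x) : 𝕊 n) : 𝔼 (n + 1))) M (v : 𝔼 (n + 1))) :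
    M v = f v := by
  -- the curve `c ↦ c • v` through `v` at `c = 1`
  have hcurve : HasDerivAt (fun c : ℝ => c • (v : 𝔼 (n + 1))) (v : 𝔼 (n + 1)) 1 := by
    simpa using (hasDerivAt_id (1 : ℝ)).smul_const (v : 𝔼 (n + 1))
  have hcomp := hM.comp_hasDerivAt_of_eq 1 hcurve (one_smul _ _).symm
  -- along the curve the extension is `c ↦ c • f v` near `c = 1`
  have hev : (fun c : ℝ => ‖c • (v : 𝔼 (n + 1))‖ •
      ((f (radialProjection v (c • (v : 𝔼 (n + 1)))) : 𝕊 n) : 𝔼 (n + 1))) =ᶠ[𝓝 1]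
      fun c : ℝ => c • ((f v : 𝕊 n) : 𝔼 (n + 1)) := by
    filter_upwards [lt_mem_nhds (zero_lt_one' ℝ)] with c hc
    rw [homExt_smul v f hc, homExt_coe_sphere]
  have h2 : HasDerivAt (fun c : ℝ => c • ((f v : 𝕊 n) : 𝔼 (n + 1)))
      ((f v : 𝕊 n) : 𝔼 (n + 1)) 1 := by
    simpa using (hasDerivAt_id (1 : ℝ)).smul_const ((f v : 𝕊 n) : 𝔼 (n + 1))
  have h3 : HasDerivAt (fun c : ℝ => c • ((f v : 𝕊 n) : 𝔼 (n + 1))) (M (v : 𝔼 (n + 1))) 1 :=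
    hcomp.congr_of_eventuallyEq hev.symm
  exact h3.unique h2

/-- **Tangency of the `1`-jet**: with `M` as above, `⟪f v, M ξ⟫ = ⟪v, ξ⟫` for all `ξ`
(differentiate `‖extension x‖² = ‖x‖²`). In particular `M` maps `vᗮ` into `(f v)ᗮ`. [folklore] -/
theorem inner_homExt_fderiv (v : 𝕊 n) (f : (𝕊 n) → 𝕊 n) {M : 𝔼 (n + 1) →L[ℝ] 𝔼 (n + 1)}
    (hM : HasFDerivAt (fun x : 𝔼 (n + 1) =>
      ‖x‖ • ((f (radialProjection v x) : 𝕊 n) : 𝔼 (n + 1))) M (v : 𝔼 (n + 1)))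
    (ξ : 𝔼 (n + 1)) : ⟪((f v : 𝕊 n) : 𝔼 (n + 1)), M ξ⟫ = ⟪(v : 𝔼 (n + 1)), ξ⟫ := by
  have h1 := hM.norm_sq
  have h2 : HasFDerivAt (fun x : 𝔼 (n + 1) => ‖x‖ ^ 2)
      (2 • (innerSL ℝ (v : 𝔼 (n + 1)))) (v : 𝔼 (n + 1)) := by
    simpa using (hasFDerivAt_id (v : 𝔼 (n + 1))).norm_sq
  have heq : (fun x : 𝔼 (n + 1) => ‖‖x‖ • ((f (radialProjection v x) : 𝕊 n) : 𝔼 (n + 1))‖ ^ 2) =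
      fun x => ‖x‖ ^ 2 := by
    funext x; rw [norm_homExt]
  rw [heq] at h1
  have h3 := h1.unique h2
  have h4 := congrArg (fun L : 𝔼 (n + 1) →L[ℝ] ℝ => L ξ) h3
  simp only [smul_apply, ContinuousLinearMap.comp_apply, innerSL_apply_apply, nsmul_eq_mul] at h4
  have hv : ‖(v : 𝔼 (n + 1))‖ • ((f (radialProjection v (v : 𝔼 (n + 1)))) : 𝔼 (n + 1)) =
      ((f v : 𝕊 n) : 𝔼 (n + 1)) := homExt_coe_sphere v f v
  rw [hv] at h4
  push_cast at h4
  linarith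

/-- **Invertibility of the `1`-jet**: if `g` inverts `f` on the left (`g (f z) = z`), and `M`,
`M'` are the differentials of the homogeneous extensions of `f` at `v` and of `g` at `f v`, then
`M' ∘ M = 1`; in particular `M` is injective. [folklore] -/
theorem homExt_fderiv_leftInverse (v : 𝕊 n) {f g : (𝕊 n) → 𝕊 n} (hgf : ∀ z, g (f z) = z)
    {M M' : 𝔼 (n + 1) →L[ℝ] 𝔼 (n + 1)}
    (hM : HasFDerivAt (fun x : 𝔼 (n + 1) =>
      ‖x‖ • ((f (radialProjection v x) : 𝕊 n) : 𝔼 (n + 1))) M (v : 𝔼 (n + 1)))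
    (hM' : HasFDerivAt (fun x : 𝔼 (n + 1) =>
      ‖x‖ • ((g (radialProjection v x) : 𝕊 n) : 𝔼 (n + 1))) M' ((f v : 𝕊 n) : 𝔼 (n + 1))) :
    M'.comp M = 1 := by
  have hpt : ‖(v : 𝔼 (n + 1))‖ • ((f (radialProjection v (v : 𝔼 (n + 1)))) : 𝔼 (n + 1)) =
      ((f v : 𝕊 n) : 𝔼 (n + 1)) := homExt_coe_sphere v f v
  have hcomp := (hpt ▸ hM').comp (v : 𝔼 (n + 1)) hM
  -- the composite is the identity off the origin
  have hev : ((fun x : 𝔼 (n + 1) => ‖x‖ • ((g (radialProjection v x) : 𝕊 n) : 𝔼 (n + 1))) ∘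
      fun x : 𝔼 (n + 1) =>
        ‖x‖ • ((f (radialProjection v x) : 𝕊 n) : 𝔼 (n + 1))) =ᶠ[𝓝 (v : 𝔼 (n + 1))]
      id := by
    have hv0 : (v : 𝔼 (n + 1)) ≠ 0 := ne_zero_of_mem_unit_sphere v
    filter_upwards [isOpen_ne.mem_nhds hv0] with x hx
    simp only [comp_apply, id]
    rw [norm_homExt, radialProjection_homExt v f hx, hgf, homExt_id hx]
  have h2 : HasFDerivAt id (M'.comp M) (v : 𝔼 (n + 1)) := hcomp.congr_of_eventuallyEq hev.symm
  exact (h2.unique (hasFDerivAt_id _)).trans rfl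

/-- The homogeneous extension of a map which is the identity near `v` on the sphere is the
identity near `v` in `ℝⁿ⁺¹`. [folklore] -/
theorem homExt_eventuallyEq_id (v : 𝕊 n) {f : (𝕊 n) → 𝕊 n} (hf : ∀ᶠ z in 𝓝 v, f z = z) :
    (fun x : 𝔼 (n + 1) => ‖x‖ • ((f (radialProjection v x) : 𝕊 n) : 𝔼 (n + 1)))
      =ᶠ[𝓝 (v : 𝔼 (n + 1))] id := by
  have hv0 : (v : 𝔼 (n + 1)) ≠ 0 := ne_zero_of_mem_unit_sphere v
  have hcont : ContinuousAt (radialProjection v) (v : 𝔼 (n + 1)) :=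
    (contMDiffAt_radialProjection v hv0).continuousAt
  have hv' : radialProjection v (v : 𝔼 (n + 1)) = v := radialProjection_coe_sphere v v
  rw [← hv'] at hf
  filter_upwards [hcont.eventually hf, isOpen_ne.mem_nhds hv0] with x hx hx0
  rw [hx, id, homExt_id hx0]

/-! ## §3 The stereographic chart at `v`, through the ambient formulas -/

/-- **The stereographic chart centred at `v` and its inverse, read in `ℝⁿ⁺¹`.** With
`κ = stereographic' n (-v)` (projection from the antipode, `κ v = 0`), `U y = κ⁻¹ y ∈ 𝕊ⁿ ⊆ ℝⁿ⁺¹`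
and `V` the ambient formula of `κ` (`stereographic'_apply_eq`): `U` is smooth with `U 0 = v`,
`‖U y‖ = 1`, `V` is smooth near `v`, `V ∘ U = id`, and the differentials `DU = DU(0)`,
`DV = DV(v)` satisfy `DV ∘ DU = 1`, `range DU ⊆ vᗮ`, and every vector orthogonal to `v` is in
the range of `DU` (dimension count). [folklore] -/
theorem exists_stereoChart_frame (v : 𝕊 n) :
    ∃ (DU : 𝔼 n →L[ℝ] 𝔼 (n + 1)) (DV : 𝔼 (n + 1) →L[ℝ] 𝔼 n),
      HasFDerivAt (fun y : 𝔼 n => (((stereographic' n (-v)).symm y : 𝕊 n) : 𝔼 (n + 1))) DU 0 ∧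
      HasFDerivAt (fun x : 𝔼 (n + 1) => Literature.Geometry.Conformal.stereoIsometry n (-v)
        ((2 / (1 - ⟪(((-v : 𝕊 n)) : 𝔼 (n + 1)), x⟫)) •
          (ℝ ∙ (((-v : 𝕊 n)) : 𝔼 (n + 1)))ᗮ.orthogonalProjectionOnto x)) DV (v : 𝔼 (n + 1)) ∧
      DV.comp DU = 1 ∧ (∀ η, ⟪(v : 𝔼 (n + 1)), DU η⟫ = 0) ∧
      (∀ ξ : 𝔼 (n + 1), ⟪(v : 𝔼 (n + 1)), ξ⟫ = 0 → ∃ η, DU η = ξ) := by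
  set κ := stereographic' n (-v) with hκ
  set U : 𝔼 n → 𝔼 (n + 1) := fun y => ((κ.symm y : 𝕊 n) : 𝔼 (n + 1)) with hU
  set V : 𝔼 (n + 1) → 𝔼 n := fun x => Literature.Geometry.Conformal.stereoIsometry n (-v)
    ((2 / (1 - ⟪(((-v : 𝕊 n)) : 𝔼 (n + 1)), x⟫)) •
      (ℝ ∙ (((-v : 𝕊 n)) : 𝔼 (n + 1)))ᗮ.orthogonalProjectionOnto x) with hV
  have hv0 : (v : 𝔼 (n + 1)) ≠ 0 := ne_zero_of_mem_unit_sphere v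
  have hv1 : ⟪(v : 𝔼 (n + 1)), (v : 𝔼 (n + 1))⟫ = 1 := by
    rw [real_inner_self_eq_norm_sq, norm_eq_of_mem_sphere, one_pow]
  -- `U` is smooth, `U 0 = v`, `‖U‖ = 1`
  have hUs : ContDiff ℝ ∞ U :=
    (contMDiff_coe_sphere.comp (contMDiff_stereographic'_symm (-v))).contDiff
  have hU0 : U 0 = v := by
    simp only [hU, hκ, stereographic'_symm_zero, neg_neg]
  have hUn : ∀ y, ‖U y‖ = 1 := fun y => norm_eq_of_mem_sphere _
  -- `V` is smooth near `v`
  have hVs : ContDiffAt ℝ ∞ V (v : 𝔼 (n + 1)) := by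
    have h1 : ContDiffOn ℝ ∞ (stereoToFun (((-v : 𝕊 n)) : 𝔼 (n + 1)))
        {x : 𝔼 (n + 1) | innerSL ℝ (((-v : 𝕊 n)) : 𝔼 (n + 1)) x ≠ (1 : ℝ)} :=
      contDiffOn_stereoToFun
    have hmem : (v : 𝔼 (n + 1)) ∈
        {x : 𝔼 (n + 1) | innerSL ℝ (((-v : 𝕊 n)) : 𝔼 (n + 1)) x ≠ (1 : ℝ)} := by
      show innerSL ℝ (((-v : 𝕊 n)) : 𝔼 (n + 1)) (v : 𝔼 (n + 1)) ≠ 1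
      rw [innerSL_apply_apply, coe_neg_sphere, inner_neg_left, hv1]
      norm_num
    have hopen : IsOpen {x : 𝔼 (n + 1) | innerSL ℝ (((-v : 𝕊 n)) : 𝔼 (n + 1)) x ≠ (1 : ℝ)} :=
      isOpen_ne_fun (innerSL ℝ _).continuous continuous_const
    have h2 : ContDiffAt ℝ ∞ (stereoToFun (((-v : 𝕊 n)) : 𝔼 (n + 1))) (v : 𝔼 (n + 1)) :=
      h1.contDiffAt (hopen.mem_nhds hmem)
    exact (Literature.Geometry.Conformal.stereoIsometry n (-v)).contDiff.contDiffAt.comp _ h2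
  -- `V ∘ U = id`
  have hVU : ∀ y, V (U y) = y := by
    intro y
    have h1 : V (U y) = κ (κ.symm y) := by
      rw [hκ, stereographic'_apply_eq]
    rw [h1, hκ, stereographic'_stereographic'_symm]
  -- differentials
  set DU := fderiv ℝ U 0 with hDU
  set DV := fderiv ℝ V (v : 𝔼 (n + 1)) with hDV
  have hdU : HasFDerivAt U DU 0 := (hUs.differentiable (by simp) 0).hasFDerivAt
  have hdV : HasFDerivAt V DV (v : 𝔼 (n + 1)) := (hVs.differentiableAt (by simp)).hasFDerivAt
  have hcomp : DV.comp DU = 1 := by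
    have h1 : HasFDerivAt (V ∘ U) (DV.comp DU) 0 := (hU0 ▸ hdV).comp 0 hdU
    have h2 : (V ∘ U) = id := funext hVU
    rw [h2] at h1
    exact h1.unique (hasFDerivAt_id _)
  have htan : ∀ η, ⟪(v : 𝔼 (n + 1)), DU η⟫ = 0 := by
    intro η
    have h1 := hdU.norm_sq
    have h2 : (fun y : 𝔼 n => ‖U y‖ ^ 2) = fun _ => 1 := by
      funext y; rw [hUn, one_pow]
    rw [h2, hU0] at h1
    have h3 := h1.unique (hasFDerivAt_const (1 : ℝ) (0 : 𝔼 n))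
    have h4 := congrArg (fun L : 𝔼 n →L[ℝ] ℝ => L η) h3
    simp only [smul_apply, ContinuousLinearMap.comp_apply, innerSL_apply_apply, nsmul_eq_mul,
      zero_apply] at h4
    push_cast at h4
    linarith
  -- dimension count: `range DU = vᗮ`
  have hrange : ∀ ξ : 𝔼 (n + 1), ⟪(v : 𝔼 (n + 1)), ξ⟫ = 0 → ∃ η, DU η = ξ := by
    have hinj : Injective DU := by
      intro a b hab
      have := congrArg DV hab
      rwa [← ContinuousLinearMap.comp_apply, ← ContinuousLinearMap.comp_apply, hcomp,
        one_apply_eq_self, one_apply_eq_self] at this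
    have hle : LinearMap.range (DU : 𝔼 n →ₗ[ℝ] 𝔼 (n + 1)) ≤ (ℝ ∙ (v : 𝔼 (n + 1)))ᗮ := by
      rintro ξ ⟨η, rfl⟩
      rw [Submodule.mem_orthogonal_singleton_iff_inner_right]
      exact htan η
    have h1 : finrank ℝ (LinearMap.range (DU : 𝔼 n →ₗ[ℝ] 𝔼 (n + 1))) = n := by
      rw [LinearMap.finrank_range_of_inj hinj, finrank_euclideanSpace_fin]
    have h2 : finrank ℝ (ℝ ∙ (v : 𝔼 (n + 1)))ᗮ = n :=
      Submodule.finrank_orthogonal_span_singleton hv0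
    have heq := Submodule.eq_of_le_of_finrank_eq hle (h1.trans h2.symm)
    intro ξ hξ
    have hmem : ξ ∈ (ℝ ∙ (v : 𝔼 (n + 1)))ᗮ := by
      rw [Submodule.mem_orthogonal_singleton_iff_inner_right]; exact hξ
    rw [← heq] at hmem
    obtain ⟨η, hη⟩ := hmem
    exact ⟨η, hη⟩
  exact ⟨DU, DV, hdU, hdV, hcomp, htan, hrange⟩

/-! ## §4 The frame loop -/

/-- There is an orthonormal basis of `ℝⁿ⁺¹` indexed by `Fin (n + 1)` whose `0`-th vector is a
given unit vector. [folklore] -/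
theorem exists_orthonormalBasis_zero_eq (v : 𝕊 n) :
    ∃ b : OrthonormalBasis (Fin (n + 1)) ℝ (𝔼 (n + 1)), b 0 = v := by
  have hcard : finrank ℝ (𝔼 (n + 1)) = Fintype.card (Fin (n + 1)) := by
    rw [finrank_euclideanSpace_fin, Fintype.card_fin]
  have hon : Orthonormal ℝ (({0} : Set (Fin (n + 1))).restrict fun _ : Fin (n + 1) =>
      (v : 𝔼 (n + 1))) := by
    refine ⟨fun i => norm_eq_of_mem_sphere v, ?_⟩
    intro i j hij
    exact absurd (Subsingleton.elim i j) hij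
  obtain ⟨b, hb⟩ := hon.exists_orthonormalBasis_extension_of_card_eq hcard
  exact ⟨b, hb 0 rfl⟩
set_option maxHeartbeats 400000 in -- buildfix (bf3-g26): 160k/180k FAIL, 200k PASS at accept time; line-neutral budget line
/-- **The Gram–Schmidt frame loop of a diffeotopy of `𝕊ⁿ` at a point.** Let `D` be a
diffeotopy of `𝕊ⁿ` with `D_t = id` for `t ≤ 0`, `D_t = D_1` for `t ≥ 1`, and `D_1 = id` near
`v`. There is a smooth loop `t ↦ A_t` of linear isometries of `ℝⁿ⁺¹` (`A_t = 1` for `t ≤ 0` and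
for `t ≥ 1`) with `A_t v = D_t v`, such that for the family `E_t = A_t⁻¹ ∘ D_t` read in the
stereographic chart `σ_{-v}` centred at `v`, `e_t = σ_{-v} ∘ E_t ∘ σ_{-v}⁻¹ : ℝⁿ → ℝⁿ`, every
segment `(1 - s) De_t(0) + s · 1` (`s ∈ [0, 1]`) is invertible. `A_t` is the isometry taking an
orthonormal basis `b` with `b 0 = v` to the Gram–Schmidt orthonormalisation of its image under
the differential at `v` of the homogeneous extension of `D_t`; invertibility of the segments is
the flag-positivity of Gram–Schmidt (`isUnit_segment_of_flagPositive`) transported to the chart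
(`exists_stereoChart_frame`). This is the tree's substitute for Cerf's use of
`Emb(Dⁿ, Sⁿ) ≃ SO(n+1)` (Appendice, Prop. 3) in the proof of Proposition 4.
[cite: CerfDiffeoSphere1968, Appendice §5, Prop. 3 and Prop. 4] -/
theorem exists_frameLoop (D : Diffeotopy (𝓡 n) (𝕊 n)) (v : 𝕊 n)
    (hD0 : ∀ t ≤ (0 : ℝ), D.toFun t = id) (hD1 : ∀ t, (1 : ℝ) ≤ t → D.toFun t = D.toFun 1)
    (hφ : ∀ᶠ z in 𝓝 v, D.toFun 1 z = z) :
    ∃ A : ℝ → (𝔼 (n + 1) ≃ₗᵢ[ℝ] 𝔼 (n + 1)),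
      ContDiff ℝ ∞ (fun t => (A t : 𝔼 (n + 1) →L[ℝ] 𝔼 (n + 1))) ∧
      (∀ t ≤ (0 : ℝ), A t = LinearIsometryEquiv.refl ℝ (𝔼 (n + 1))) ∧
      (∀ t, (1 : ℝ) ≤ t → A t = LinearIsometryEquiv.refl ℝ (𝔼 (n + 1))) ∧
      (∀ t, A t v = D.toFun t v) ∧
      ∀ t, ∀ s ∈ Icc (0 : ℝ) 1, IsUnit ((1 - s) • fderiv ℝ (fun y : 𝔼 n =>
          stereographic' n (-v) (sphereCongr (A t).symm
            (D.toFun t ((stereographic' n (-v)).symm y)))) 0 + s • (1 : 𝔼 n →L[ℝ] 𝔼 n)) := by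
  have hv0 : (v : 𝔼 (n + 1)) ≠ 0 := ne_zero_of_mem_unit_sphere v
  have hv1 : ‖(v : 𝔼 (n + 1))‖ = 1 := norm_eq_of_mem_sphere v
  -- the homogeneous extensions of the stages and of the inverse stages
  set Fh : ℝ → 𝔼 (n + 1) → 𝔼 (n + 1) := fun t x =>
    ‖x‖ • ((D.toFun t (radialProjection v x) : 𝕊 n) : 𝔼 (n + 1)) with hFh
  have hFh_at : ∀ t, ∀ x : 𝔼 (n + 1), x ≠ 0 → ContDiffAt ℝ ∞ (uncurry Fh) (t, x) :=
    fun t x hx => contDiffAt_homExt_family v D.contMDiff_uncurry_toFun hx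
  have hFh_slice : ∀ t, ∀ x : 𝔼 (n + 1), x ≠ 0 → ContDiffAt ℝ ∞ (Fh t) x := fun t x hx =>
    (hFh_at t x hx).comp x (contDiffAt_const.prodMk contDiffAt_id)
  -- the `1`-jet loop `M t = D(Fh t)(v)`
  set M : ℝ → 𝔼 (n + 1) →L[ℝ] 𝔼 (n + 1) := fun t => fderiv ℝ (Fh t) (v : 𝔼 (n + 1)) with hM
  have hM_smooth : ContDiff ℝ ∞ M := by
    rw [contDiff_iff_contDiffAt]
    intro t
    exact (hFh_at t _ hv0).fderiv (contDiffAt_const (c := (v : 𝔼 (n + 1)))) (by simp)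
  have hM_deriv : ∀ t, HasFDerivAt (Fh t) (M t) (v : 𝔼 (n + 1)) := fun t =>
    ((hFh_slice t _ hv0).differentiableAt (by simp)).hasFDerivAt
  have hM_id : ∀ t, (∀ᶠ z in 𝓝 v, D.toFun t z = z) → M t = 1 := by
    intro t ht
    show fderiv ℝ (Fh t) (v : 𝔼 (n + 1)) = 1
    rw [(homExt_eventuallyEq_id v ht).fderiv_eq, fderiv_id]
    rfl
  have hM0 : ∀ t ≤ (0 : ℝ), M t = 1 := fun t ht =>
    hM_id t (Eventually.of_forall fun z => by rw [hD0 t ht, id])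
  have hM1 : ∀ t, (1 : ℝ) ≤ t → M t = 1 := fun t ht =>
    hM_id t (by simpa only [hD1 t ht] using hφ)
  have hMv : ∀ t, M t (v : 𝔼 (n + 1)) = D.toFun t v := fun t =>
    homExt_fderiv_apply_self v (D.toFun t) (hM_deriv t)
  have hMinner : ∀ t (ξ : 𝔼 (n + 1)),
      ⟪((D.toFun t v : 𝕊 n) : 𝔼 (n + 1)), M t ξ⟫ = ⟪(v : 𝔼 (n + 1)), ξ⟫ := fun t ξ =>
    inner_homExt_fderiv v (D.toFun t) (hM_deriv t) ξ
  have hMinj : ∀ t, Injective (M t) := by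
    intro t
    have hGd : ContDiffAt ℝ ∞ (fun x : 𝔼 (n + 1) =>
        ‖x‖ • ((D.invFun t (radialProjection v x) : 𝕊 n) : 𝔼 (n + 1)))
        ((D.toFun t v : 𝕊 n) : 𝔼 (n + 1)) :=
      contDiffAt_homExt v (D.contMDiff_invFun t) (ne_zero_of_mem_unit_sphere _)
    have h1 := homExt_fderiv_leftInverse v (f := D.toFun t) (g := D.invFun t)
      (D.invFun_toFun t) (hM_deriv t) ((hGd.differentiableAt (by simp)).hasFDerivAt)
    intro a b hab
    have := congrArg (fderiv ℝ (fun x : 𝔼 (n + 1) =>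
      ‖x‖ • ((D.invFun t (radialProjection v x) : 𝕊 n) : 𝔼 (n + 1)))
      ((D.toFun t v : 𝕊 n) : 𝔼 (n + 1))) hab
    rwa [← ContinuousLinearMap.comp_apply, ← ContinuousLinearMap.comp_apply, h1,
      one_apply_eq_self, one_apply_eq_self] at this
  -- an orthonormal basis with `b 0 = v`, its images, and their Gram–Schmidt orthonormalisation
  obtain ⟨b, hb0⟩ := exists_orthonormalBasis_zero_eq v
  set u : ℝ → Fin (n + 1) → 𝔼 (n + 1) := fun t i => M t (b i) with hu
  have hu_li : ∀ t, LinearIndependent ℝ (u t) := fun t =>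
    b.toBasis.linearIndependent.map' (M t : 𝔼 (n + 1) →ₗ[ℝ] 𝔼 (n + 1))
      (LinearMap.ker_eq_bot.mpr (by exact hMinj t))
  have hu_smooth : ∀ i, ContDiff ℝ ∞ fun t => u t i := fun i =>
    hM_smooth.clm_apply contDiff_const
  have hu_id : ∀ t, M t = 1 → u t = ⇑b := fun t ht => by
    funext i; simp [hu, ht]
  set gsn : ℝ → Fin (n + 1) → 𝔼 (n + 1) := fun t i => gramSchmidtNormed ℝ (u t) i with hgsn
  have hgsn_smooth : ∀ i, ContDiff ℝ ∞ fun t => gsn t i := fun i =>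
    contDiff_gramSchmidtNormed hu_smooth hu_li i
  have hgsn_on : ∀ t, Orthonormal ℝ (gsn t) := fun t => gramSchmidtNormed_orthonormal (hu_li t)
  have hgsn_norm : ∀ t i, ‖gsn t i‖ = 1 := fun t i => gramSchmidtNormed_unit_length i (hu_li t)
  have hgsn_ne : ∀ t i, gsn t i ≠ 0 := fun t i => by
    rw [← norm_ne_zero_iff, hgsn_norm]; exact one_ne_zero
  have hgs_ne : ∀ t i, gramSchmidt ℝ (u t) i ≠ 0 := fun t i => gramSchmidt_ne_zero i (hu_li t)
  -- Gram–Schmidt of the orthonormal basis itself is the basis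
  have hgsn_id : ∀ t, M t = 1 → gsn t = ⇑b := by
    intro t ht
    funext i
    simp only [hgsn, hu_id t ht]
    rw [gramSchmidtNormed, gramSchmidt_of_orthogonal ℝ b.orthonormal.2, b.orthonormal.1 i]
    simp
  -- the orthonormal basis `c t = gsn t` and the isometry `A t : b ↦ c t`
  have hcard : finrank ℝ (𝔼 (n + 1)) = Fintype.card (Fin (n + 1)) := by
    rw [finrank_euclideanSpace_fin, Fintype.card_fin]
  set c : ℝ → OrthonormalBasis (Fin (n + 1)) ℝ (𝔼 (n + 1)) := fun t =>
    gramSchmidtOrthonormalBasis hcard (u t) with hc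
  have hc_apply : ∀ t i, c t i = gsn t i := fun t i =>
    gramSchmidtOrthonormalBasis_apply hcard (hgsn_ne t i)
  set A : ℝ → (𝔼 (n + 1) ≃ₗᵢ[ℝ] 𝔼 (n + 1)) := fun t => b.equiv (c t) (Equiv.refl _) with hA
  have hA_b : ∀ t i, A t (b i) = gsn t i := fun t i => by
    rw [hA]
    show (b.equiv (c t) (Equiv.refl _)) (b i) = gsn t i
    rw [OrthonormalBasis.equiv_apply_basis, Equiv.refl_apply, hc_apply]
  have hA_symm : ∀ t i, (A t).symm (gsn t i) = b i := fun t i => by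
    rw [← hA_b t i, LinearIsometryEquiv.symm_apply_apply]
  -- the isometry as a rank-one sum, for smoothness in `t`
  have hA_sum : ∀ t, (A t : 𝔼 (n + 1) →L[ℝ] 𝔼 (n + 1)) = ∑ i,
      ContinuousLinearMap.smulRightL ℝ (𝔼 (n + 1)) (𝔼 (n + 1)) (innerSL ℝ (b i)) (gsn t i) := by
    intro t
    refine ContinuousLinearMap.ext fun x => ?_
    rw [FunLike.coe_sum, Finset.sum_apply]
    simp only [ContinuousLinearMap.smulRightL_apply_apply]
    show A t x = ∑ i, ⟪b i, x⟫ • gsn t i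
    rw [hA]
    show (b.equiv (c t) (Equiv.refl _)) x = _
    rw [OrthonormalBasis.equiv_apply]
    simp only [Equiv.refl_apply, OrthonormalBasis.repr_apply_apply, hc_apply]
  have hA_smooth : ContDiff ℝ ∞ fun t => (A t : 𝔼 (n + 1) →L[ℝ] 𝔼 (n + 1)) := by
    have : (fun t => (A t : 𝔼 (n + 1) →L[ℝ] 𝔼 (n + 1))) = fun t => ∑ i,
        ContinuousLinearMap.smulRightL ℝ (𝔼 (n + 1)) (𝔼 (n + 1)) (innerSL ℝ (b i)) (gsn t i) :=
      funext hA_sum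
    rw [this]
    exact ContDiff.sum fun i _ =>
      (ContinuousLinearMap.smulRightL ℝ (𝔼 (n + 1)) (𝔼 (n + 1)) (innerSL ℝ (b i))).contDiff.comp
        (hgsn_smooth i)
  -- the loop condition
  have hA_id : ∀ t, M t = 1 → A t = LinearIsometryEquiv.refl ℝ (𝔼 (n + 1)) := by
    intro t ht
    apply b.toBasis.ext_linearIsometryEquiv
    intro i
    rw [OrthonormalBasis.coe_toBasis, hA_b, hgsn_id t ht]
    rfl
  have hA0 : ∀ t ≤ (0 : ℝ), A t = LinearIsometryEquiv.refl ℝ (𝔼 (n + 1)) := fun t ht =>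
    hA_id t (hM0 t ht)
  have hA1 : ∀ t, (1 : ℝ) ≤ t → A t = LinearIsometryEquiv.refl ℝ (𝔼 (n + 1)) := fun t ht =>
    hA_id t (hM1 t ht)
  -- `A t v = D_t v`
  have hAv : ∀ t, A t v = D.toFun t v := by
    intro t
    rw [← hb0, hA_b]
    simp only [hgsn, gramSchmidtNormed]
    have h0 : gramSchmidt ℝ (u t) 0 = M t (b 0) := by
      rw [← bot_eq_zero, gramSchmidt_bot]
    have h1 : M t (b 0) = D.toFun t v := by rw [hb0, hMv]
    rw [h0, h1, norm_eq_of_mem_sphere, RCLike.ofReal_real_eq_id, id_eq, inv_one, one_smul]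
  -- flag-positivity of `T t = (A t)⁻¹ ∘ M t`
  set T : ℝ → 𝔼 (n + 1) →L[ℝ] 𝔼 (n + 1) := fun t =>
    ((A t).symm : 𝔼 (n + 1) →L[ℝ] 𝔼 (n + 1)).comp (M t) with hT
  have hT_apply : ∀ t x, T t x = (A t).symm (M t x) := fun t x => rfl
  have hT_flag : ∀ t k, T t (b k) ∈ Submodule.span ℝ (b '' Set.Iic k) := by
    intro t k
    have h1 : u t k ∈ Submodule.span ℝ (gsn t '' Set.Iic k) := by
      rw [hgsn, span_gramSchmidtNormed, span_gramSchmidt_Iic]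
      exact Submodule.subset_span ⟨k, Set.mem_Iic.mpr le_rfl, rfl⟩
    have h2 := Submodule.apply_mem_span_image_of_mem_span
      ((A t).symm : 𝔼 (n + 1) →ₗ[ℝ] 𝔼 (n + 1)) h1
    have h3 : ((A t).symm : 𝔼 (n + 1) →ₗ[ℝ] 𝔼 (n + 1)) '' (gsn t '' Set.Iic k) =
        b '' Set.Iic k := by
      rw [Set.image_image]
      refine Set.image_congr fun i _ => ?_
      exact hA_symm t i
    rw [h3] at h2
    exact h2
  have hT_pos : ∀ t k, 0 < ⟪b k, T t (b k)⟫ := by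
    intro t k
    rw [hT_apply, ← LinearIsometryEquiv.inner_map_eq_flip, hA_b]
    show 0 < ⟪gramSchmidtNormed ℝ (u t) k, u t k⟫
    rw [gramSchmidtNormed, inner_smul_left, inner_gramSchmidt_self]
    simp only [RCLike.ofReal_real_eq_id, id_eq, map_inv₀, RCLike.conj_to_real]
    have hpos : 0 < ‖gramSchmidt ℝ (u t) k‖ := norm_pos_iff.mpr (hgs_ne t k)
    rw [sq, ← mul_assoc, inv_mul_cancel₀ hpos.ne', one_mul]
    exact hpos
  have hT_perp : ∀ t (ξ : 𝔼 (n + 1)), ⟪(v : 𝔼 (n + 1)), ξ⟫ = 0 → ⟪(v : 𝔼 (n + 1)), T t ξ⟫ = 0 := by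
    intro t ξ hξ
    rw [hT_apply, ← LinearIsometryEquiv.inner_map_eq_flip, hAv, hMinner, hξ]
  have hT_inj : ∀ t, ∀ s ∈ Icc (0 : ℝ) 1,
      Injective ((1 - s) • T t + s • (1 : 𝔼 (n + 1) →L[ℝ] 𝔼 (n + 1))) := by
    intro t s hs
    have hu := isUnit_segment_of_flagPositive b (T t) (hT_flag t) (hT_pos t) hs
    exact (ContinuousLinearMap.isUnit_iff_bijective.mp hu).1
  -- the chart and the chain rule
  obtain ⟨DU, DV, hdU, hdV, hVU, hUtan, hUrange⟩ := exists_stereoChart_frame v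
  set κ := stereographic' n (-v) with hκ
  have hU0 : (((κ.symm 0 : 𝕊 n)) : 𝔼 (n + 1)) = v := by
    simp only [hκ, stereographic'_symm_zero, neg_neg]
  have he_eq : ∀ t, (fun y : 𝔼 n => κ (sphereCongr (A t).symm (D.toFun t (κ.symm y)))) =
      (fun x : 𝔼 (n + 1) => Literature.Geometry.Conformal.stereoIsometry n (-v)
        ((2 / (1 - ⟪(((-v : 𝕊 n)) : 𝔼 (n + 1)), x⟫)) •
          (ℝ ∙ (((-v : 𝕊 n)) : 𝔼 (n + 1)))ᗮ.orthogonalProjectionOnto x)) ∘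
      (fun x : 𝔼 (n + 1) => (A t).symm (Fh t x)) ∘
      (fun y : 𝔼 n => (((κ.symm y : 𝕊 n)) : 𝔼 (n + 1))) := by
    intro t
    funext y
    have h1 : Fh t ((((κ.symm y : 𝕊 n)) : 𝔼 (n + 1))) =
        ((D.toFun t (κ.symm y) : 𝕊 n) : 𝔼 (n + 1)) := homExt_coe_sphere v (D.toFun t) _
    simp only [comp_apply, h1]
    rw [hκ, stereographic'_apply_eq, coe_sphereCongr]
  have he_deriv : ∀ t,
      HasFDerivAt (fun y : 𝔼 n => κ (sphereCongr (A t).symm (D.toFun t (κ.symm y))))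
        (DV.comp ((T t).comp DU)) 0 := by
    intro t
    rw [he_eq t]
    have h1 : HasFDerivAt (fun x : 𝔼 (n + 1) => (A t).symm (Fh t x)) (T t)
        (((κ.symm 0 : 𝕊 n)) : 𝔼 (n + 1)) := by
      rw [hU0]
      exact ((A t).symm : 𝔼 (n + 1) →L[ℝ] 𝔼 (n + 1)).hasFDerivAt.comp _ (hM_deriv t)
    have hpt : (A t).symm (Fh t (((κ.symm 0 : 𝕊 n)) : 𝔼 (n + 1))) = v := by
      rw [hU0]
      show (A t).symm (‖(v : 𝔼 (n + 1))‖ •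
        ((D.toFun t (radialProjection v (v : 𝔼 (n + 1))) : 𝕊 n) : 𝔼 (n + 1))) = v
      rw [homExt_coe_sphere, ← hAv, LinearIsometryEquiv.symm_apply_apply]
    have hdV' : HasFDerivAt (fun x : 𝔼 (n + 1) =>
        Literature.Geometry.Conformal.stereoIsometry n (-v)
          ((2 / (1 - ⟪(((-v : 𝕊 n)) : 𝔼 (n + 1)), x⟫)) •
          (ℝ ∙ (((-v : 𝕊 n)) : 𝔼 (n + 1)))ᗮ.orthogonalProjectionOnto x)) DV
        ((A t).symm (Fh t (((κ.symm 0 : 𝕊 n)) : 𝔼 (n + 1)))) := by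
      rw [hpt]; exact hdV
    have h2 : HasFDerivAt ((fun x : 𝔼 (n + 1) => (A t).symm (Fh t x)) ∘
        fun y : 𝔼 n => (((κ.symm y : 𝕊 n)) : 𝔼 (n + 1))) ((T t).comp DU) 0 :=
      HasFDerivAt.comp (0 : 𝔼 n) h1 hdU
    exact HasFDerivAt.comp (0 : 𝔼 n) hdV' h2
  -- conclusion
  refine ⟨A, hA_smooth, hA0, hA1, hAv, fun t s hs => ?_⟩
  rw [(he_deriv t).fderiv]
  have h1c : ((1 : 𝔼 (n + 1) →L[ℝ] 𝔼 (n + 1))).comp DU = DU := ContinuousLinearMap.ext fun _ => rfl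
  have halg : (1 - s) • DV.comp ((T t).comp DU) + s • (1 : 𝔼 n →L[ℝ] 𝔼 n) =
      DV.comp ((((1 - s) • T t + s • (1 : 𝔼 (n + 1) →L[ℝ] 𝔼 (n + 1)))).comp DU) := by
    rw [ContinuousLinearMap.add_comp, ContinuousLinearMap.comp_add, ContinuousLinearMap.smul_comp,
      ContinuousLinearMap.comp_smul, ContinuousLinearMap.smul_comp, ContinuousLinearMap.comp_smul,
      h1c, hVU]
  rw [halg]
  -- injectivity of `DV ∘ S ∘ DU`, `S` the segment
  set S := (1 - s) • T t + s • (1 : 𝔼 (n + 1) →L[ℝ] 𝔼 (n + 1)) with hS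
  have hSperp : ∀ ξ : 𝔼 (n + 1), ⟪(v : 𝔼 (n + 1)), ξ⟫ = 0 → ⟪(v : 𝔼 (n + 1)), S ξ⟫ = 0 := by
    intro ξ hξ
    simp only [hS, add_apply, smul_apply, one_apply_eq_self,
      inner_add_right, inner_smul_right, hT_perp t ξ hξ, hξ, mul_zero, add_zero]
  have key : ∀ θ : 𝔼 n, DV (S (DU θ)) = 0 → θ = 0 := by
    intro θ hθ
    obtain ⟨θ', hθ'⟩ := hUrange (S (DU θ)) (hSperp _ (hUtan θ))
    have h1 : θ' = 0 := by
      have := congrArg DV hθ'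
      rwa [← ContinuousLinearMap.comp_apply, hVU, one_apply_eq_self, hθ] at this
    rw [h1, map_zero] at hθ'
    have h2 : DU θ = 0 := hT_inj t s hs (by rw [← hθ', map_zero])
    have := congrArg DV h2
    rwa [← ContinuousLinearMap.comp_apply, hVU, one_apply_eq_self, map_zero] at this
  refine isUnit_of_injective_clm' ((injective_iff_map_eq_zero _).mpr fun θ hθ => key θ ?_)
  exact hθ

end Homogeneous

end Literature.Topology.FourManifolds
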